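import Mathlib.Analysis.Normed.Group.Ultra
import Mathlib.Analysis.Normed.Module.FiniteDimension
import Mathlib.Topology.MetricSpace.HausdorffDistance
import Mathlib.LinearAlgebra.Projection
import HarnessLib

/-!
# Orthogonal complements and ISOMETRY EXTENSION in finite-dimensional ultrametric normed spaces

Classical non-archimedean functional analysis (nothing disputed).  Over a complete nontrivially normed field `𝕜`,
let `K` be an ULTRAMETRIC normed `𝕜`-space which is proper (closed balls compact; e.g. any finite extension of `ℚ_p`,
any finite-dimensional normed space over a local field).  Then:

* `norm_add_smul_eq_max_of_forall_le` — a best-approximation residual `u` of a subspace `D`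
  (`‖u‖ ≤ ‖u + d‖` for all `d ∈ D`) is NORM-ORTHOGONAL to `D`: `‖d + a•u‖ = max ‖d‖ ‖a•u‖`;
* **`exists_orthogonal_isCompl`** — every subspace `D ≤ K` has a norm-orthogonal complement `C`
  (`K = D ⊕ C`, `‖d + c‖ = max ‖d‖ ‖c‖`): induction on the codimension, the new direction being a
  best-approximation residual (it exists because `D` is closed and `K` is proper);
* **`exists_isometry_extension`** — hence every norm-preserving linear endomorphism `f` of a subspace `D`
  extends to a norm-preserving linear AUTOMORPHISM `G` of `K` (`G = f ⊕ id_C`).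

Use (abc-iut cell, R-J row Y-29b): a `ℚ_p`-linear isometry prescribed on a finite-dimensional subfield
`ℚ_p(…) ⊆ K_w` extends to an isometry of the whole completion `K_w`, so exhibits of «isometries moving the maximal
order of a tensor packet» ASCEND from the exhibit field to every local field containing it.  Proof-only file.
[cite: SerreLocalFields1979, Ch. II §1] [cite: NeukirchANT1999, Ch. II (4.8)–(4.9)]
-/

noncomputable section

open Metric Set Module

namespace Literature.IUT.LogVolume

namespace UltrametricComplement

variable {𝕜 : Type*} [NontriviallyNormedField 𝕜] [CompleteSpace 𝕜]
  {K : Type*} [NormedAddCommGroup K] [NormedSpace 𝕜 K] [IsUltrametricDist K]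

omit [CompleteSpace 𝕜] in
/-- A best-approximation residual `u` of a subspace `D` (`‖u‖ ≤ ‖u + d‖` for all `d ∈ D`) is norm-orthogonal to
`D`: `‖d + a•u‖ = max ‖d‖ ‖a•u‖`. [cite: SerreLocalFields1979, Ch. II §1] -/
theorem norm_add_smul_eq_max_of_forall_le (D : Submodule 𝕜 K) {u : K} (hu : ∀ d ∈ D, ‖u‖ ≤ ‖u + d‖)
    {d : K} (hd : d ∈ D) (a : 𝕜) : ‖d + a • u‖ = max ‖d‖ ‖a • u‖ := by
  apply le_antisymm (IsUltrametricDist.norm_add_le_max _ _)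
  have h1 : ‖a • u‖ ≤ ‖d + a • u‖ := by
    by_cases ha : a = 0
    · rw [ha, zero_smul, norm_zero]
      exact norm_nonneg _
    · have h : d + a • u = a • (u + a⁻¹ • d) := by
        rw [smul_add, smul_smul, mul_inv_cancel₀ ha, one_smul, add_comm]
      rw [h, norm_smul, norm_smul]
      exact mul_le_mul_of_nonneg_left (hu _ (D.smul_mem _ hd)) (norm_nonneg _)
  have h2 : ‖d‖ ≤ ‖d + a • u‖ :=
    calc ‖d‖ = ‖(d + a • u) + -(a • u)‖ := by rw [add_neg_cancel_right]
      _ ≤ max ‖d + a • u‖ ‖-(a • u)‖ := IsUltrametricDist.norm_add_le_max _ _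
      _ = max ‖d + a • u‖ ‖a • u‖ := by rw [norm_neg]
      _ ≤ ‖d + a • u‖ := max_le le_rfl h1
  exact max_le h2 h1

variable [ProperSpace K]

/-- **Every subspace of a proper ultrametric normed space has a NORM-ORTHOGONAL COMPLEMENT**: for `D ≤ K` there is
`C ≤ K` with `K = D ⊕ C` and `‖d + c‖ = max ‖d‖ ‖c‖` (`d ∈ D`, `c ∈ C`).  Induction on the codimension: a vector
`x ∉ D` has a best approximation `d₀ ∈ D` (`D` is closed, `K` proper), the residual `u = x − d₀` is orthogonal to `D`,
and `C = 𝕜u ⊕ C₁` for an orthogonal complement `C₁` of `D ⊕ 𝕜u`. [cite: SerreLocalFields1979, Ch. II §1] -/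
theorem exists_orthogonal_isCompl (D : Submodule 𝕜 K) :
    ∃ C : Submodule 𝕜 K, IsCompl D C ∧ ∀ d ∈ D, ∀ c ∈ C, ‖d + c‖ = max ‖d‖ ‖c‖ := by
  haveI : FiniteDimensional 𝕜 K := FiniteDimensional.of_locallyCompactSpace 𝕜
  suffices h : ∀ n : ℕ, ∀ D : Submodule 𝕜 K, finrank 𝕜 K - finrank 𝕜 D = n →
      ∃ C : Submodule 𝕜 K, IsCompl D C ∧ ∀ d ∈ D, ∀ c ∈ C, ‖d + c‖ = max ‖d‖ ‖c‖ from h _ D rfl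
  intro n
  induction n using Nat.strong_induction_on with
  | _ n ih =>
  intro D hn
  by_cases htop : D = ⊤
  · refine ⟨⊥, by rw [htop]; exact isCompl_top_bot, fun d _ c hc => ?_⟩
    rw [(Submodule.mem_bot 𝕜).mp hc, add_zero, norm_zero, max_eq_left (norm_nonneg _)]
  -- a vector outside `D` and its best approximation in the closed set `D`
  obtain ⟨x, hx⟩ : ∃ x : K, x ∉ D := by
    by_contra h
    exact htop (Submodule.eq_top_iff'.mpr fun x => not_not.mp (not_exists.mp h x))
  have hDc : IsClosed (D : Set K) := D.closed_of_finiteDimensional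
  obtain ⟨d₀, hd₀, hdist⟩ := hDc.exists_infDist_eq_dist ⟨0, D.zero_mem⟩ x
  set u := x - d₀ with hu_def
  have huD : u ∉ D := by
    intro h
    apply hx
    have h' : u + d₀ ∈ D := D.add_mem h hd₀
    rwa [hu_def, sub_add_cancel] at h'
  have hu : ∀ d ∈ D, ‖u‖ ≤ ‖u + d‖ := by
    intro d hd
    have h1 : ‖u‖ = infDist x (D : Set K) := by rw [hdist, dist_eq_norm]
    have h2 : infDist x (D : Set K) ≤ dist x (d₀ - d) := infDist_le_dist_of_mem (D.sub_mem hd₀ hd)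
    rw [h1, hu_def, show x - d₀ + d = x - (d₀ - d) by abel, ← dist_eq_norm]
    exact h2
  -- the subspace `D₁ = D ⊕ 𝕜u` has smaller codimension
  set D₁ := D ⊔ Submodule.span 𝕜 {u} with hD₁
  have huD₁ : ∀ a : 𝕜, a • u ∈ D₁ := fun a =>
    Submodule.mem_sup_right (Submodule.smul_mem _ a (Submodule.mem_span_singleton_self u))
  have hlt : D < D₁ := by
    refine lt_of_le_of_ne le_sup_left fun h => huD ?_
    rw [h]
    simpa using huD₁ 1
  have hcodim : finrank 𝕜 K - finrank 𝕜 D₁ < n := by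
    have h1 := Submodule.finrank_lt_finrank_of_lt hlt
    have h2 := Submodule.finrank_le D₁
    omega
  obtain ⟨C₁, hC₁, horth₁⟩ := ih _ hcodim D₁ rfl
  refine ⟨Submodule.span 𝕜 {u} ⊔ C₁, ⟨?_, ?_⟩, ?_⟩
  · -- `D ⊓ (𝕜u ⊕ C₁) = 0`
    rw [Submodule.disjoint_def]
    intro d hd hdc
    obtain ⟨y, hy, c, hcC, rfl⟩ := Submodule.mem_sup.mp hdc
    obtain ⟨a, rfl⟩ := Submodule.mem_span_singleton.mp hy
    have hcD₁ : c ∈ D₁ := by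
      have h : c = (a • u + c) - a • u := by rw [add_sub_cancel_left]
      rw [h]
      exact D₁.sub_mem (Submodule.mem_sup_left hd) (huD₁ a)
    have hc0 : c = 0 := Submodule.disjoint_def.mp hC₁.disjoint c hcD₁ hcC
    rw [hc0, add_zero] at hd ⊢
    by_cases ha : a = 0
    · rw [ha, zero_smul]
    · exfalso
      apply huD
      have h := D.smul_mem a⁻¹ hd
      rwa [smul_smul, inv_mul_cancel₀ ha, one_smul] at h
  · -- `D + 𝕜u + C₁ = K`
    rw [codisjoint_iff, ← sup_assoc]
    exact hC₁.sup_eq_top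
  · -- orthogonality
    intro d hd c hcc
    obtain ⟨y, hy, c₁, hc₁, rfl⟩ := Submodule.mem_sup.mp hcc
    obtain ⟨a, rfl⟩ := Submodule.mem_span_singleton.mp hy
    have hdu : d + a • u ∈ D₁ := D₁.add_mem (Submodule.mem_sup_left hd) (huD₁ a)
    calc ‖d + (a • u + c₁)‖ = ‖(d + a • u) + c₁‖ := by rw [add_assoc]
      _ = max ‖d + a • u‖ ‖c₁‖ := horth₁ _ hdu _ hc₁
      _ = max (max ‖d‖ ‖a • u‖) ‖c₁‖ := by rw [norm_add_smul_eq_max_of_forall_le D hu hd a]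
      _ = max ‖d‖ (max ‖a • u‖ ‖c₁‖) := max_assoc _ _ _
      _ = max ‖d‖ ‖a • u + c₁‖ := by rw [horth₁ _ (huD₁ a) _ hc₁]

/-- **ISOMETRY EXTENSION.**  A norm-preserving `𝕜`-linear endomorphism `f` of a subspace `D` of a proper ultrametric
normed space `K` extends to a norm-preserving `𝕜`-linear AUTOMORPHISM `G` of `K` (`G = f ⊕ id` along a
norm-orthogonal complement; norm-preserving endomorphisms of finite-dimensional spaces are bijective).
[cite: SerreLocalFields1979, Ch. II §1] -/
theorem exists_isometry_extension (D : Submodule 𝕜 K) (f : D →ₗ[𝕜] D)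
    (hf : ∀ d : D, ‖((f d : D) : K)‖ = ‖(d : K)‖) :
    ∃ G : K ≃ₗ[𝕜] K, (∀ x, ‖G x‖ = ‖x‖) ∧ ∀ d : D, G (d : K) = ((f d : D) : K) := by
  haveI : FiniteDimensional 𝕜 K := FiniteDimensional.of_locallyCompactSpace 𝕜
  obtain ⟨C, hDC, horth⟩ := exists_orthogonal_isCompl D
  let G₀ : K →ₗ[𝕜] K := LinearMap.ofIsCompl hDC (D.subtype ∘ₗ f) C.subtype
  have hG₀D : ∀ d : D, G₀ (d : K) = ((f d : D) : K) := fun d => LinearMap.ofIsCompl_apply_left hDC d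
  have hG₀C : ∀ c : C, G₀ (c : K) = (c : K) := fun c => LinearMap.ofIsCompl_apply_right hDC c
  have hG₀ : ∀ x, ‖G₀ x‖ = ‖x‖ := by
    intro x
    have hx : x ∈ D ⊔ C := by rw [hDC.sup_eq_top]; exact Submodule.mem_top
    obtain ⟨d, hd, c, hc, rfl⟩ := Submodule.mem_sup.mp hx
    rw [map_add, hG₀D ⟨d, hd⟩, hG₀C ⟨c, hc⟩, horth _ (f ⟨d, hd⟩).2 _ hc, horth _ hd _ hc, hf]
  have hinj : Function.Injective G₀ := by
    rw [← LinearMap.ker_eq_bot, LinearMap.ker_eq_bot']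
    intro x hx
    rw [← norm_eq_zero, ← hG₀ x, hx, norm_zero]
  exact ⟨LinearEquiv.ofInjectiveEndo G₀ hinj, fun x => hG₀ x, fun d => hG₀D d⟩

end UltrametricComplement

end Literature.IUT.LogVolume

end
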